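import Literature.Analysis.FluidPDE.StatisticalSolutionEnergyEq
import Literature.Analysis.FluidPDE.EnergySpaceTorusGalerkinProofs
import Literature.Analysis.FluidPDE.StatisticalSolutionDirac
import Literature.Analysis.FluidPDE.CylindricalGenerator
import Literature.Analysis.FunctionSpaces.TorusTruncationH1
import Literature.Analysis.FluidPDE.StokesTorusProofs
import HarnessLib

/-!
# Stub `stub_galerkinTail` (T) of line `floor_duality_galerkin`, crux `TameRoughRigidity.GPEulerCoercive`
# (stmt-AnomalousDissipation-18400)

GALERKIN TAIL ABSORPTION. Let a cylindrical test functional `Ψ` on `H = L²_σ(T³)` read only the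
Galerkin modes of order `M` (`(v, gᵢ) = (P_M v, gᵢ)` for all `v ∈ L²`), and let its differentials
`w = Ψ'(v)` obey the uniform pointwise strain bound `|⟨∇w(x) e, e⟩| ≤ S |e|²` with
`0 ≤ S < λ_M := 4π²(M² + 1)` (the smallest Stokes eigenvalue above the truncation). If the
GALERKIN certificate `Γ + S²|y|²/(λ_M − S) ≤ ‖∇y‖² + ⟨f − B(y,y), Ψ'(y)⟩` holds at every
`y ∈ H ∩ galerkinSpace M`, then the FLOOR certificate `Γ ≤ ‖∇v‖² + ⟨f − B(v,v), Ψ'(v)⟩` holds at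
every finite-enstrophy `v ∈ H` (the generator is `Torus.nsGeneratorPairing 0 f v (Ψ.grad v)`,
Foias–Manley–Rosa–Temam 2001, Ch. IV (1.11)/(1.30) at `ν = 0`).

Proof (folklore bookkeeping around the tree's Galerkin/Fourier infrastructure). Write `u` for the
representative of `v`, `t = T_M u` for its Fourier truncation (`Torus.fourierTruncate`; on `H` this
is `P_M v` a.e., `Torus.coeFn_galerkinProj_of_mem`) and `z = u − t`.

* `Ψ.coords v = Ψ.coords (P_M v)`, hence `Ψ'(v) = Ψ'(P_M v) =: w` (the low-mode hypothesis).
* Spectral Pythagoras `‖∇u‖² = ‖∇t‖² + ‖∇(t − u)‖²` (`Torus.eGradNormSq_eq_add_fourierTruncate`)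
  and the tail gap `λ_M ∫|t − u|² ≤ ‖∇(t − u)‖²` (`Torus.lintegral_enorm_sq_fourierTruncate_sub_le`
  and `tailGradNormSq M u ≤ ‖∇(t − u)‖²`, the tail carrying exactly the modes `|k|² ≥ M² + 1`).
* Pointwise strain algebra (`inner_add_sub_inner_ge`): for a linear `D` with `|⟨De, e⟩| ≤ S|e|²`,
  polarisation with the parallelogram law and the scaling `a ↦ c a` give
  `⟨Da, b⟩ + ⟨Db, a⟩ ≥ −S(c|a|² + |b|²/c)` for every `c > 0`; with `c = S/(λ − S)` and
  `⟨Db, b⟩ ≥ −S|b|²` this is `⟨D(a + b), a + b⟩ − ⟨Da, a⟩ ≥ −(S²/(λ − S)|a|² + λ|b|²)`.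
  Integrated (`a = t(x)`, `b = z(x)`, all integrands in `L¹` since `u, t ∈ L²` and `∇w` is
  bounded): `∫⟨∇w u, u⟩ − ∫⟨∇w t, t⟩ ≥ −(S²/(λ − S) ∫|t|² + λ ∫|z|²)`.
* Endgame: `‖∇u‖² + ⟨f − B(u,u), w⟩ ≥ [‖∇t‖² + ⟨f − B(t,t), w⟩ − S²|t|²/(λ − S)] + [‖∇z‖² − λ|z|²]
  ≥ Γ + 0` by the Galerkin certificate at `y = P_M v` (`|y|² = ∫|t|²`, `‖∇y‖² = ‖∇t‖²`).

No new definitions, no named facts. `eGradNormSq_congr_ae` is a private copy of the Literature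
survivor `Torus.eGradNormSq_congr_ae_field` (`SteadyNavierStokesProofs`), which is not in this
file's import closure.

## References

* C. Foias, O. Manley, R. Rosa, R. Temam, *Navier–Stokes Equations and Turbulence*, CUP (2001),
  Ch. IV §1.1 (1.7)–(1.11), §1.2 Def. 1.2–1.3, (1.27)–(1.31). [FMRTTurbulence2001]
* J. C. Robinson, J. L. Rodrigo, W. Sadowski, *The Three-Dimensional Navier–Stokes Equations*,
  CUP (2016), §4.1 (4.1), Lemma 4.1 (Galerkin truncation, Poincaré on the tail). [RobinsonRodrigoSadowski2016]
-/

-- `Summit.<Summit>.<Problem>` is the tree's mandated summit-side namespace (CONVENTIONS §2); single-conjunct summit, duplicate deliberate.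
set_option linter.dupNamespace false

noncomputable section

namespace Summit.AnomalousDissipation.AnomalousDissipation.Theorems.TameRoughRigidity.GPEulerCoercive

open MeasureTheory Filter Topology UnitAddTorus
open scoped InnerProductSpace RealInnerProductSpace ENNReal NNReal
open Literature.Analysis.FunctionSpaces Literature.Analysis.FluidPDE

/-- Local notation: real vector fields on `T³`. -/
local notation "Vec3" => (UnitAddTorus (Fin 3)) → (EuclideanSpace ℝ (Fin 3))
/-- Local notation: `L²(T³; ℝ³)`. -/
local notation "L2" => (Lp (EuclideanSpace ℝ (Fin 3)) 2 (volume : Measure (UnitAddTorus (Fin 3))))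
/-- Local notation: the energy space `H`. -/
local notation "H3" => (Torus.energySpace (Fin 3))

/-! ### Pointwise strain algebra -/

/-- **Polarised strain bound with a free scale.** If a (continuous) linear map `D` of a real inner
product space has quadratic form bounded by `S`, `|⟪D e, e⟫| ≤ S‖e‖²`, then for every `c > 0` the
symmetrised cross term obeys `⟪D a, b⟫ + ⟪D b, a⟫ ≥ −(S c ‖a‖² + (S/c) ‖b‖²)`: apply the bound to
`c a ± b`, subtract (`⟪D(p+q), p+q⟫ − ⟪D(p−q), p−q⟫ = 2(⟪Dp, q⟫ + ⟪Dq, p⟫)`) and use the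
parallelogram law `‖ca + b‖² + ‖ca − b‖² = 2(c²‖a‖² + ‖b‖²)`. [folklore] -/
theorem cross_inner_ge {E : Type*} [NormedAddCommGroup E] [InnerProductSpace ℝ E]
    (D : E →L[ℝ] E) {S : ℝ} (hD : ∀ e, |⟪D e, e⟫_ℝ| ≤ S * ‖e‖ ^ 2) (a b : E) {c : ℝ}
    (hc : 0 < c) : -(S * c * ‖a‖ ^ 2 + S / c * ‖b‖ ^ 2) ≤ ⟪D a, b⟫_ℝ + ⟪D b, a⟫_ℝ := by
  have h1 := (abs_le.1 (hD (c • a + b))).1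
  have h2 := (abs_le.1 (hD (c • a - b))).2
  have hpar : ‖c • a + b‖ ^ 2 + ‖c • a - b‖ ^ 2 = 2 * (‖c • a‖ ^ 2 + ‖b‖ ^ 2) :=
    parallelogram_law_with_norm ℝ (c • a) b
  have hn : ‖c • a‖ = c * ‖a‖ := by rw [norm_smul, Real.norm_of_nonneg hc.le]
  have hparS : S * ‖c • a + b‖ ^ 2 + S * ‖c • a - b‖ ^ 2 =
      2 * S * (c ^ 2 * ‖a‖ ^ 2 + ‖b‖ ^ 2) := by
    rw [← mul_add, hpar, hn]
    ring
  have hid : ⟪D (c • a + b), c • a + b⟫_ℝ - ⟪D (c • a - b), c • a - b⟫_ℝ =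
      2 * c * (⟪D a, b⟫_ℝ + ⟪D b, a⟫_ℝ) := by
    simp only [map_add, map_sub, map_smul, inner_add_left, inner_add_right, inner_sub_left,
      inner_sub_right, real_inner_smul_left, real_inner_smul_right]
    ring
  have hcX : -(S * (c ^ 2 * ‖a‖ ^ 2 + ‖b‖ ^ 2)) ≤ c * (⟪D a, b⟫_ℝ + ⟪D b, a⟫_ℝ) := by
    linarith [h1, h2, hparS, hid]
  have hmul : c * (-(S * c * ‖a‖ ^ 2 + S / c * ‖b‖ ^ 2)) =
      -(S * (c ^ 2 * ‖a‖ ^ 2 + ‖b‖ ^ 2)) := by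
    rw [mul_neg, mul_add, ← mul_assoc c (S / c), mul_div_cancel₀ S hc.ne']
    ring
  refine le_of_mul_le_mul_left ?_ hc
  rw [hmul]
  exact hcX

/-- **The tail algebra, pointwise.** If `|⟪D e, e⟫| ≤ S‖e‖²` for all `e` with `0 ≤ S < l`, then for
all `a, b`: `⟪D(a + b), a + b⟫ − ⟪D a, a⟫ ≥ −(S²/(l − S) ‖a‖² + l ‖b‖²)` — expand,
`⟪Db, b⟫ ≥ −S‖b‖²`, and `cross_inner_ge` with the optimal scale `c = S/(l − S)` (for `S = 0` the
cross term and `⟪Db, b⟫` are nonnegative). This is the minimisation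
`(l − S)‖b‖² − 2S‖a‖‖b‖ + S²‖a‖²/(l − S) ≥ 0` of the line's blueprint. [folklore] -/
theorem inner_add_sub_inner_ge {E : Type*} [NormedAddCommGroup E] [InnerProductSpace ℝ E]
    (D : E →L[ℝ] E) {S l : ℝ} (hD : ∀ e, |⟪D e, e⟫_ℝ| ≤ S * ‖e‖ ^ 2) (hS : 0 ≤ S) (hSl : S < l)
    (a b : E) :
    -(S ^ 2 / (l - S) * ‖a‖ ^ 2 + l * ‖b‖ ^ 2) ≤ ⟪D (a + b), a + b⟫_ℝ - ⟪D a, a⟫_ℝ := by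
  have hexp : ⟪D (a + b), a + b⟫_ℝ - ⟪D a, a⟫_ℝ = (⟪D a, b⟫_ℝ + ⟪D b, a⟫_ℝ) + ⟪D b, b⟫_ℝ := by
    simp only [map_add, inner_add_left, inner_add_right]
    ring
  have hbb : -(S * ‖b‖ ^ 2) ≤ ⟪D b, b⟫_ℝ := (abs_le.1 (hD b)).1
  have hlS : 0 < l - S := sub_pos.2 hSl
  rw [hexp]
  rcases hS.eq_or_lt with rfl | hSpos
  · have h := cross_inner_ge D hD a b one_pos
    have hl0 : 0 ≤ l * ‖b‖ ^ 2 := mul_nonneg (by linarith) (sq_nonneg _)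
    norm_num at h hbb ⊢
    linarith
  · have hc : 0 < S / (l - S) := div_pos hSpos hlS
    have h := cross_inner_ge D hD a b hc
    have e1 : S * (S / (l - S)) = S ^ 2 / (l - S) := by ring
    have e2 : S / (S / (l - S)) = l - S := by
      field_simp
    rw [e1, e2] at h
    linarith [h, hbb]

/-! ### Spectral bookkeeping for the truncation tail -/

/-- The spectral enstrophy only depends on the a.e. class of the field (its Fourier coefficients
do, `Torus.mFourierCoeff_congr_ae`). Private copy of the Literature survivor
`Torus.eGradNormSq_congr_ae_field` (`SteadyNavierStokesProofs`), not reachable from this file's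
imports. [folklore] -/
private theorem eGradNormSq_congr_ae {v w : Vec3} (h : v =ᵐ[volume] w) :
    Torus.eGradNormSq v = Torus.eGradNormSq w := by
  rw [Torus.eGradNormSq_eq_tsum, Torus.eGradNormSq_eq_tsum]
  simp_rw [Torus.mFourierCoeff_congr_ae (h.fun_comp EuclideanSpace.complexify)]

/-- **The tail enstrophy is the enstrophy of the truncation error** (inequality form): for
integrable `u`, `tailGradNormSq M u = 4π² ∑_{|k|>M} |k|² ‖û(k)‖² ≤ ‖∇(T_M u − u)‖₂²`, since
`(T_M u − u)^(k) = −û(k)` off the ball and `0` on it (`Torus.mFourierCoeff_fourierTruncate_sub`;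
Robinson–Rodrigo–Sadowski 2016, Lemma 4.1: `Q_n = I − P_n` carries the modes `> n`). [folklore] -/
theorem tailGradNormSq_le_eGradNormSq_sub {u : Vec3} (hu : Integrable u volume) (M : ℕ) :
    Torus.tailGradNormSq M u ≤ Torus.eGradNormSq (Torus.fourierTruncate M u - u) := by
  rw [Torus.tailGradNormSq, Torus.eGradNormSq_eq_tsum]
  refine mul_le_mul' le_rfl ?_
  calc ∑' k : {k : Fin 3 → ℤ // k ∉ Torus.freqBall M},
        ENNReal.ofReal (Torus.freqNormSq (k : Fin 3 → ℤ)) *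
          ‖mFourierCoeff (EuclideanSpace.complexify ∘ u) (k : Fin 3 → ℤ)‖ₑ ^ 2
      = ∑' k : {k : Fin 3 → ℤ // k ∉ Torus.freqBall M},
          ENNReal.ofReal (Torus.freqNormSq (k : Fin 3 → ℤ)) *
            ‖mFourierCoeff (EuclideanSpace.complexify ∘ (Torus.fourierTruncate M u - u))
              (k : Fin 3 → ℤ)‖ₑ ^ 2 :=
        tsum_congr fun k => by
          rw [Torus.mFourierCoeff_fourierTruncate_sub hu M, if_neg k.2, enorm_neg]
    _ ≤ ∑' k : Fin 3 → ℤ, ENNReal.ofReal (Torus.freqNormSq k) *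
          ‖mFourierCoeff (EuclideanSpace.complexify ∘ (Torus.fourierTruncate M u - u)) k‖ₑ ^ 2 :=
        ENNReal.tsum_comp_le_tsum_of_injective Subtype.val_injective
          (fun k => ENNReal.ofReal (Torus.freqNormSq k) *
            ‖mFourierCoeff (EuclideanSpace.complexify ∘ (Torus.fourierTruncate M u - u)) k‖ₑ ^ 2)

/-- **Enstrophy splitting with the tail spectral gap** (real form, finite enstrophy): for `u ∈ L²`
with `‖∇u‖₂² < ∞`, `‖∇u‖₂² = ‖∇T_M u‖₂² + ‖∇(T_M u − u)‖₂²` (`Torus.eGradNormSq_eq_add_fourierTruncate`,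
disjoint Fourier supports) and `4π²(M² + 1) ∫ ‖T_M u − u‖² ≤ ‖∇(T_M u − u)‖₂²` (the tail has only
modes `|k|² ≥ M² + 1`: `Torus.lintegral_enorm_sq_fourierTruncate_sub_le` with
`tailGradNormSq_le_eGradNormSq_sub`; Robinson–Rodrigo–Sadowski 2016, Lemma 4.1). [folklore] -/
theorem toReal_eGradNormSq_split {u : Vec3} (hu2 : MemLp u 2 volume)
    (hfin : Torus.eGradNormSq u ≠ ⊤) (M : ℕ) :
    (Torus.eGradNormSq u).toReal =
        (Torus.eGradNormSq (Torus.fourierTruncate M u)).toReal +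
          (Torus.eGradNormSq (Torus.fourierTruncate M u - u)).toReal ∧
      4 * Real.pi ^ 2 * ((M : ℝ) ^ 2 + 1) * (∫ x, ‖Torus.fourierTruncate M u x - u x‖ ^ 2) ≤
        (Torus.eGradNormSq (Torus.fourierTruncate M u - u)).toReal := by
  have hu1 : Integrable u volume := hu2.integrable one_le_two
  have hsub2 : MemLp (fun x => Torus.fourierTruncate M u x - u x) 2 volume :=
    (Torus.memLp_fourierTruncate M u 2).sub hu2
  have hsplit := Torus.eGradNormSq_eq_add_fourierTruncate hu1 M
  have hfin' : Torus.eGradNormSq (Torus.fourierTruncate M u) +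
      Torus.eGradNormSq (Torus.fourierTruncate M u - u) ≠ ⊤ := hsplit ▸ hfin
  obtain ⟨hGt, hGz⟩ := ENNReal.add_ne_top.1 hfin'
  refine ⟨by rw [hsplit, ENNReal.toReal_add hGt hGz], ?_⟩
  have h := (Torus.lintegral_enorm_sq_fourierTruncate_sub_le hu2 M).trans
    (tailGradNormSq_le_eGradNormSq_sub hu1 M)
  rw [← Torus.ofReal_integral_norm_sq_eq_lintegral hsub2, ← ENNReal.ofReal_mul (by positivity),
    ← ENNReal.ofReal_mul (by positivity), ENNReal.ofReal_le_iff_le_toReal hGz] at h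
  linarith [h]

/-! ### The inertial term: only the tail is paid for -/

/-- **Inertial tail estimate.** For `v ∈ H`, a smooth field `w` with pointwise strain
`|⟪∇w(x) e, e⟫| ≤ S‖e‖²`, `0 ≤ S < l`, and `t = T_M v` (`= P_M v` a.e. on `H`,
`Torus.coeFn_galerkinProj_of_mem`):
`∫ (v ⊗ v) : ∇w − ∫ (P_M v ⊗ P_M v) : ∇w ≥ −(S²/(l − S) ∫‖t‖² + l ∫‖t − v‖²)` — the pointwise
inequality `inner_add_sub_inner_ge` at `a = t(x)`, `b = v(x) − t(x)`, integrated (every integrand is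
in `L¹`: `v, t ∈ L²`, `∇w` bounded, `Torus.integrable_inner_fderiv_apply_coe`). The trilinear
bookkeeping is FMRT 2001, Ch. IV (1.7)–(1.9). [folklore] -/
theorem inertialPairing_sub_galerkinProj_ge {v : L2} (hv : v ∈ Torus.energySpace (Fin 3)) (M : ℕ)
    {w : Vec3} (hw : Torus.IsSmooth w) {S l : ℝ}
    (hD : ∀ (x : UnitAddTorus (Fin 3)) (e : EuclideanSpace ℝ (Fin 3)),
      |⟪Torus.fderiv w x e, e⟫_ℝ| ≤ S * ‖e‖ ^ 2)
    (hS : 0 ≤ S) (hSl : S < l) :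
    -(S ^ 2 / (l - S) * (∫ x, ‖Torus.fourierTruncate M (v : Vec3) x‖ ^ 2) +
        l * (∫ x, ‖Torus.fourierTruncate M (v : Vec3) x - (v : Vec3) x‖ ^ 2)) ≤
      Torus.inertialPairing v w -
        Torus.inertialPairing ((Torus.galerkinProj M : L2 →L[ℝ] L2) v) w := by
  unfold Torus.inertialPairing
  set u : Vec3 := (v : Vec3) with hu_def
  set t : Vec3 := Torus.fourierTruncate M u with ht_def
  have hu2 : MemLp u 2 volume := Lp.memLp v
  have ht2 : MemLp t 2 volume := Torus.memLp_fourierTruncate M u 2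
  have hsub2 : MemLp (fun x => t x - u x) 2 volume := ht2.sub hu2
  have hae : (((Torus.galerkinProj M : L2 →L[ℝ] L2) v : L2) : Vec3) =ᵐ[volume] t :=
    Torus.coeFn_galerkinProj_of_mem hv M
  obtain ⟨C, -, hC⟩ := Torus.exists_sum_norm_partialDeriv_le hw
  have hIu : Integrable (fun x => ⟪Torus.fderiv w x (u x), u x⟫_ℝ) volume :=
    (Torus.integrable_inner_fderiv_apply_coe hw hC v v).1
  have hIt : Integrable (fun x => ⟪Torus.fderiv w x (t x), t x⟫_ℝ) volume :=
    (Torus.integrable_inner_fderiv_apply_coe hw hC ((Torus.galerkinProj M : L2 →L[ℝ] L2) v)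
      ((Torus.galerkinProj M : L2 →L[ℝ] L2) v)).1.congr
      (by filter_upwards [hae] with x hx; rw [hx])
  have hIyt : ∫ x, ⟪Torus.fderiv w x ((((Torus.galerkinProj M : L2 →L[ℝ] L2) v : L2) : Vec3) x),
      (((Torus.galerkinProj M : L2 →L[ℝ] L2) v : L2) : Vec3) x⟫_ℝ =
        ∫ x, ⟪Torus.fderiv w x (t x), t x⟫_ℝ :=
    integral_congr_ae (by filter_upwards [hae] with x hx; rw [hx])
  rw [hIyt, ← integral_sub hIu hIt]
  have hpt : ∀ x, -(S ^ 2 / (l - S) * ‖t x‖ ^ 2 + l * ‖t x - u x‖ ^ 2) ≤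
      ⟪Torus.fderiv w x (u x), u x⟫_ℝ - ⟪Torus.fderiv w x (t x), t x⟫_ℝ := fun x => by
    have h := inner_add_sub_inner_ge (Torus.fderiv w x) (hD x) hS hSl (t x) (u x - t x)
    rwa [add_sub_cancel, norm_sub_rev] at h
  have h1 : Integrable (fun x => S ^ 2 / (l - S) * ‖t x‖ ^ 2) volume :=
    (ht2.integrable_norm_pow two_ne_zero).const_mul _
  have h2 : Integrable (fun x => l * ‖t x - u x‖ ^ 2) volume :=
    (hsub2.integrable_norm_pow two_ne_zero).const_mul _
  have hRint : Integrable (fun x => -(S ^ 2 / (l - S) * ‖t x‖ ^ 2 + l * ‖t x - u x‖ ^ 2)) volume :=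
    (h1.add h2).neg
  have hLint : Integrable (fun x => ⟪Torus.fderiv w x (u x), u x⟫_ℝ -
      ⟪Torus.fderiv w x (t x), t x⟫_ℝ) volume := hIu.sub hIt
  have hmono := integral_mono hRint hLint hpt
  rwa [integral_neg, integral_add h1 h2, integral_const_mul, integral_const_mul] at hmono

/-! ### The stub -/

/-- **T `stub_galerkinTail`** — GALERKIN TAIL ABSORPTION (registered stub of line
`floor_duality_galerkin`, crux stmt-AnomalousDissipation-18400). Let the cylindrical `Ψ` read only
the Galerkin modes of order `M` (`(v, gᵢ) = (P_M v, gᵢ)` for all `v ∈ L²`) and let its differentials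
`Ψ'(v)` obey the uniform pointwise strain bound `|⟨∇Ψ'(v)(x) e, e⟩| ≤ S|e|²` with
`0 ≤ S < λ_M := 4π²(M² + 1)`. If the Galerkin certificate
`Γ + S²|y|²/(λ_M − S) ≤ ‖∇y‖² + ⟨f − B(y,y), Ψ'(y)⟩` holds at every `y ∈ H ∩ galerkinSpace M`, then
the floor certificate `Γ ≤ ‖∇v‖² + ⟨f − B(v,v), Ψ'(v)⟩` holds at every finite-enstrophy `v ∈ H`.
Proof: `y = P_M v ∈ H` (`Torus.galerkinSpace_le_energySpace_holds`), `Ψ.grad v = Ψ.grad y` (the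
coordinates agree by the low-mode hypothesis); `‖∇v‖² = ‖∇y‖² + ‖∇z‖²`, `‖∇z‖² ≥ λ_M|z|²`
(`toReal_eGradNormSq_split`); the inertial tail costs at most `S²|y|²/(λ_M − S) + λ_M|z|²`
(`inertialPairing_sub_galerkinProj_ge`); add up (FMRT 2001, Ch. IV (1.11), (1.30) at `ν = 0`).
[folklore] -/
theorem stub_galerkinTail (f : Vec3) (M : ℕ) (Γ S : ℝ) (Ψ : Torus.CylindricalTest (Fin 3))
    (hlow : ∀ (v : L2) (i : Fin Ψ.m),
      Torus.pairing v (Ψ.g i) = Torus.pairing ((Torus.galerkinProj M : L2 →L[ℝ] L2) v) (Ψ.g i))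
    (hstrain : ∀ (v : H3) (x : UnitAddTorus (Fin 3)) (e : EuclideanSpace ℝ (Fin 3)),
      |⟪Torus.fderiv (Ψ.grad v) x e, e⟫_ℝ| ≤ S * ‖e‖ ^ 2)
    (hS : 0 ≤ S) (hSM : S < 4 * Real.pi ^ 2 * ((M : ℝ) ^ 2 + 1))
    (hgal : ∀ y : H3, (y : L2) ∈ (Torus.galerkinSpace M : Submodule ℝ L2) →
      Γ + S ^ 2 * ‖y‖ ^ 2 / (4 * Real.pi ^ 2 * ((M : ℝ) ^ 2 + 1) - S) ≤
        (Torus.eGradNormSq ((y : L2) : Vec3)).toReal + Torus.nsGeneratorPairing 0 f y (Ψ.grad y)) :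
    ∀ v : H3, Torus.eGradNormSq ((v : L2) : Vec3) ≠ ⊤ →
      Γ ≤ (Torus.eGradNormSq ((v : L2) : Vec3)).toReal + Torus.nsGeneratorPairing 0 f v (Ψ.grad v) := by
  intro v hfin
  -- the Galerkin part `y = P_M v ∈ H`
  have hPv : (Torus.galerkinProj M : L2 →L[ℝ] L2) (v : L2) ∈
      (Torus.galerkinSpace M : Submodule ℝ L2) := Torus.galerkinProj_apply_mem M (v : L2)
  obtain ⟨y, hyv⟩ : ∃ y : H3, (y : L2) = (Torus.galerkinProj M : L2 →L[ℝ] L2) (v : L2) :=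
    ⟨⟨_, Torus.galerkinSpace_le_energySpace_holds M hPv⟩, rfl⟩
  have hPy : (y : L2) ∈ (Torus.galerkinSpace M : Submodule ℝ L2) := hyv ▸ hPv
  -- (a) `Ψ` does not see the tail: coordinates, hence differentials, agree at `v` and `y`
  have hcoords : Ψ.coords v = Ψ.coords y := by
    unfold Torus.CylindricalTest.coords
    rw [hyv]
    congr 1
    funext i
    exact hlow (v : L2) i
  have hgrad : Ψ.grad y = Ψ.grad v := by
    unfold Torus.CylindricalTest.grad
    rw [hcoords]
  have hw : Torus.IsSmooth (Ψ.grad v) := Torus.CylindricalTest.isSmooth_grad_holds Ψ v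
  -- (b) representatives: `P_M v = T_M v` a.e.
  have hu2 : MemLp ((v : L2) : Vec3) 2 volume := Lp.memLp (v : L2)
  have hae : ((y : L2) : Vec3) =ᵐ[volume] Torus.fourierTruncate M ((v : L2) : Vec3) := by
    rw [hyv]
    exact Torus.coeFn_galerkinProj_of_mem v.2 M
  have hGy : Torus.eGradNormSq ((y : L2) : Vec3) =
      Torus.eGradNormSq (Torus.fourierTruncate M ((v : L2) : Vec3)) := eGradNormSq_congr_ae hae
  have hYn : ‖y‖ ^ 2 = ∫ x, ‖Torus.fourierTruncate M ((v : L2) : Vec3) x‖ ^ 2 := by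
    rw [Submodule.coe_norm, ← Torus.integral_norm_sq_coe_eq]
    exact integral_congr_ae (by filter_upwards [hae] with x hx; rw [hx])
  -- (c) enstrophy splitting and tail gap; (d) inertial tail estimate
  obtain ⟨hGsplit, hgap⟩ := toReal_eGradNormSq_split hu2 hfin M
  have hin := inertialPairing_sub_galerkinProj_ge v.2 M hw (hstrain v) hS hSM
  -- (e) the Galerkin certificate at `y`, and the endgame
  have hcert := hgal y hPy
  rw [hgrad, hGy, hYn] at hcert
  simp only [Torus.nsGeneratorPairing, zero_mul, add_zero] at hcert ⊢
  rw [hyv] at hcert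
  have hP : S ^ 2 * (∫ x, ‖Torus.fourierTruncate M ((v : L2) : Vec3) x‖ ^ 2) /
      (4 * Real.pi ^ 2 * ((M : ℝ) ^ 2 + 1) - S) =
        S ^ 2 / (4 * Real.pi ^ 2 * ((M : ℝ) ^ 2 + 1) - S) *
          ∫ x, ‖Torus.fourierTruncate M ((v : L2) : Vec3) x‖ ^ 2 := by
    ring
  rw [hP] at hcert
  linarith [hcert, hin, hgap, hGsplit]

end Summit.AnomalousDissipation.AnomalousDissipation.Theorems.TameRoughRigidity.GPEulerCoercive

end
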